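import Literature.NumberTheory.Sieve.HeathBrownCubicTypeIICharSum
import Literature.NumberTheory.Sieve.HeathBrownCubicTypeIIOffDiag
import Mathlib.Analysis.PSeries
import Mathlib.NumberTheory.Harmonic.Bounds
import HarnessLib

/-!
# Heath-Brown's Lemma 3.10, §13 p. 78: reduced fractions and the weights `w(q)`

Support for the proof of **Lemma 3.10** of D. R. Heath-Brown, *Primes represented by `x³ + 2y³`*,
Acta Math. 186 (2001), §13 p. 78:

> "Finally we reduce the fractions `(dD)⁻¹a` to lowest terms. A given vector `q⁻¹b` with
> `h.c.f.(q, b₁, b₂, b₃) = 1` will occur with weight at most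
> `∑_{D ≥ VX⁻¹Y⁻¹} ∑_{d : q ∣ dD} (Dd)⁻² ≪ ∑_{v ≥ VX⁻¹Y⁻¹, q ∣ v} τ(v)v⁻² ≪ τ(q) XY log V/(qV)`.
> Moreover, only values `q ≤ d₀` will arise. We therefore conclude that
> `S₈ ≪ XV⁻¹ log V ∑_{q ≤ d₀} (τ(q)/q) ∑*_{b (mod q)} |S(q⁻¹b)|²` (13.2),
> where `∑*` denotes summation for `h.c.f.(q, b₁, b₂, b₃) = 1`."

All statements here are PROVED, with the weight bound in the divisor-free form
`w(q) ≤ 4(1 + log q)/(qΔ₀)` (via `∑_{D > Δ₀} (q, D)²D⁻² ≤ 2σ(q)/Δ₀` and `σ(q) ≤ q(1 + log q)`), which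
avoids the divisor-function bound used at this point in the paper:

* `CoprimeRes`, `primRes q`, `Ustar w C q = ∑*_{b (mod q)} |S(b/q; C)|²`;
* `Tsum_le_sum_divisors_Ustar`: `∑_{a (mod e)} |S(a/e)|² ≤ ∑_{q ∣ e} ∑*_{b (mod q)} |S(b/q)|²` (reduction to
  lowest terms, an injection);
* `wt Δ₀ Dmax d₀ q = ∑_{Δ₀ < D ≤ Dmax} ∑_{d ≤ d₀/D, q ∣ dD} (dD)⁻²` and **`wt_le`**: `wt ≤ 4(1 + log q)/(qΔ₀)`;
* `sum_pairs_Tsum_le`: `∑_{(D,d)} (dD)⁻² T(dD) ≤ ∑_{q ≤ d₀} wt(q) U*(q)`.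

## References

* D. R. Heath-Brown, *Primes represented by `x³ + 2y³`*, Acta Math. 186 (2001), §13 p. 78, (13.2).
  [cite: HeathBrownActa2001, §13 (13.2)]

## Mathlib / tree search

Tree: `HeathBrownCubicTypeIICharSum` (`resVecs`, `Sfrac`, `Tsum`), `HeathBrownCubicTypeIIOffDiag` (`hcf3`,
`divVec`). Mathlib: `sum_Ioo_inv_sq_le`, `harmonic_le_one_add_log`, `Nat.sum_div_divisors`.
-/

noncomputable section

open Finset

namespace Literature.NumberTheory.Sieve.CubicSieve

/-! ### Reduced residue vectors and `∑*` -/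

/-- `h.c.f.(q, b₁, b₂, b₃) = 1`. [cite: HeathBrownActa2001, §13 p. 78] -/
def CoprimeRes (q : ℕ) (b : ℤ × ℤ × ℤ) : Prop :=
  ∀ d : ℕ, d ∣ q → (d : ℤ) ∣ b.1 → (d : ℤ) ∣ b.2.1 → (d : ℤ) ∣ b.2.2 → d = 1

open scoped Classical in
/-- The reduced residue vectors `b (mod q)` with `h.c.f.(q, b) = 1`. [cite: HeathBrownActa2001, §13 p. 78] -/
def primRes (q : ℕ) : Finset (ℤ × ℤ × ℤ) := (resVecs q).filter (CoprimeRes q)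

open scoped Classical in
/-- **`∑*_{b (mod q)} |S(b/q; C)|²`**. [cite: HeathBrownActa2001, §13 (13.2)] -/
def Ustar (w : ℤ × ℤ × ℤ → ℝ) (C : Finset (ℤ × ℤ × ℤ)) (q : ℕ) : ℝ :=
  ∑ b ∈ primRes q, ‖Sfrac w C q b‖ ^ 2

/-- `Ustar ≥ 0`. [folklore] -/
theorem Ustar_nonneg (w : ℤ × ℤ × ℤ → ℝ) (C : Finset (ℤ × ℤ × ℤ)) (q : ℕ) : 0 ≤ Ustar w C q :=
  sum_nonneg fun _ _ => by positivity

/-! ### Reduction to lowest terms -/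

/-- The common factor `g = h.c.f.(e, a₁, a₂, a₃)` of a fraction `a/e`. [folklore] -/
def fracGcd (e : ℕ) (a : ℤ × ℤ × ℤ) : ℕ := Nat.gcd e (hcf3 a)

/-- The reduced denominator `q = e/g` and numerator `b = a/g`. [folklore] -/
def redFrac (e : ℕ) (a : ℤ × ℤ × ℤ) : (_ : ℕ) × (ℤ × ℤ × ℤ) :=
  ⟨e / fracGcd e a, divVec a (fracGcd e a : ℤ)⟩

/-- Basic facts on the reduction (`e ≥ 1`, `a ∈ [0,e)³`): `g ≥ 1`, `g ∣ e`, `g ∣ a`, `q g = e`,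
`a = g • b`, `b ∈ [0,q)³`, `h.c.f.(q, b) = 1`, `q ∣ e`, `q ≥ 1`. [folklore] -/
theorem redFrac_facts {e : ℕ} (he : 0 < e) {a : ℤ × ℤ × ℤ} (ha : a ∈ resVecs e) :
    1 ≤ fracGcd e a ∧ (redFrac e a).1 * fracGcd e a = e ∧ (fracGcd e a : ℤ) • (redFrac e a).2 = a ∧
      (redFrac e a).2 ∈ resVecs (redFrac e a).1 ∧ CoprimeRes (redFrac e a).1 (redFrac e a).2 ∧
      (redFrac e a).1 ∣ e ∧ 1 ≤ (redFrac e a).1 := by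
  set g := fracGcd e a with hg
  have hge : g ∣ e := Nat.gcd_dvd_left _ _
  have hga : (g : ℤ) ∣ (hcf3 a : ℤ) := by exact_mod_cast Nat.gcd_dvd_right e (hcf3 a)
  have hg1 : 1 ≤ g := Nat.pos_of_ne_zero (fun h0 => by
    have := Nat.eq_zero_of_gcd_eq_zero_left h0; omega)
  have hgZ : (0 : ℤ) < g := by exact_mod_cast hg1
  have hqg : (e / g) * g = e := Nat.div_mul_cancel hge
  have hdvda : DvdVec (g : ℤ) a :=
    ⟨hga.trans (hcf3_dvd a).1, hga.trans (hcf3_dvd a).2.1, hga.trans (hcf3_dvd a).2.2⟩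
  have hsmul : (g : ℤ) • divVec a g = a := smul_divVec hdvda
  have hq1 : 1 ≤ e / g := Nat.div_pos (Nat.le_of_dvd he hge) hg1
  rw [mem_resVecs] at ha
  obtain ⟨⟨h1l, h1u⟩, ⟨h2l, h2u⟩, ⟨h3l, h3u⟩⟩ := ha
  have hqZ : ((e / g : ℕ) : ℤ) = (e : ℤ) / g := Int.natCast_div e g
  have hbound : ∀ x : ℤ, 0 ≤ x → x < e → 0 ≤ x / g ∧ x / g < ((e / g : ℕ) : ℤ) := by
    intro x hx0 hxe
    refine ⟨Int.ediv_nonneg hx0 hgZ.le, ?_⟩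
    rw [hqZ, Int.ediv_lt_iff_lt_mul hgZ, Int.ediv_mul_cancel (by exact_mod_cast hge)]
    exact hxe
  refine ⟨hg1, hqg, hsmul, ?_, ?_, Nat.div_dvd_of_dvd hge, hq1⟩
  · rw [mem_resVecs]
    simp only [redFrac, divVec]
    exact ⟨hbound _ h1l h1u, hbound _ h2l h2u, hbound _ h3l h3u⟩
  · intro d hd hd1 hd2 hd3
    change d ∣ e / g at hd
    change (d : ℤ) ∣ a.1 / g at hd1
    change (d : ℤ) ∣ a.2.1 / g at hd2
    change (d : ℤ) ∣ a.2.2 / g at hd3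
    -- `d g ∣ e` and `d g ∣ a`, so `d g ∣ g`
    have hdg_e : d * g ∣ e := by
      obtain ⟨k, hk⟩ := hd
      exact ⟨k, by rw [← hqg, hk]; ring⟩
    have hdg_a : DvdVec ((d * g : ℕ) : ℤ) a := by
      rw [← hsmul]
      simp only [divVec, Prod.smul_mk, smul_eq_mul]
      push_cast
      exact ⟨by rw [mul_comm (d : ℤ)]; exact mul_dvd_mul_left _ hd1,
        by rw [mul_comm (d : ℤ)]; exact mul_dvd_mul_left _ hd2,
        by rw [mul_comm (d : ℤ)]; exact mul_dvd_mul_left _ hd3⟩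
    have h1 : ((d * g : ℕ) : ℤ) ∣ (hcf3 a : ℤ) := dvd_hcf3 hdg_a
    have h2 : d * g ∣ hcf3 a := by exact_mod_cast h1
    have h3 : d * g ∣ g := Nat.dvd_gcd hdg_e h2
    have h4 : d * g ≤ g := Nat.le_of_dvd hg1 h3
    have h5 : 1 ≤ d := Nat.pos_of_ne_zero (by rintro rfl; rw [zero_dvd_iff] at hd; omega)
    nlinarith

/-- The reduction does not change the fraction: `S(a/e) = S(b/q)`. [folklore] -/
theorem Sfrac_redFrac {e : ℕ} (he : 0 < e) (w : ℤ × ℤ × ℤ → ℝ) (C : Finset (ℤ × ℤ × ℤ)) {a : ℤ × ℤ × ℤ}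
    (ha : a ∈ resVecs e) : Sfrac w C e a = Sfrac w C (redFrac e a).1 (redFrac e a).2 := by
  obtain ⟨hg1, hqg, hsmul, -, -, -, hq1⟩ := redFrac_facts he ha
  refine sum_congr rfl fun v _ => ?_
  congr 1
  have hgR : (fracGcd e a : ℝ) ≠ 0 := by exact_mod_cast (show fracGcd e a ≠ 0 by omega)
  have hqR : ((redFrac e a).1 : ℝ) ≠ 0 := by exact_mod_cast (show (redFrac e a).1 ≠ 0 by omega)
  have hd : dot3 a v = (fracGcd e a : ℤ) * dot3 (redFrac e a).2 v := by
    conv_lhs => rw [← hsmul]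
    simp only [dot3, Prod.smul_fst, Prod.smul_snd, smul_eq_mul]; ring
  have heR : (e : ℝ) = ((redFrac e a).1 : ℝ) * (fracGcd e a : ℝ) := by exact_mod_cast hqg.symm
  rw [hd, heR]; push_cast
  field_simp

/-- The reduction is injective on `[0, e)³`. [folklore] -/
theorem redFrac_injOn {e : ℕ} (he : 0 < e) : Set.InjOn (redFrac e) (resVecs e : Set (ℤ × ℤ × ℤ)) := by
  intro a ha a' ha' h
  obtain ⟨hg1, hqg, hsmul, -⟩ := redFrac_facts he ha
  obtain ⟨hg1', hqg', hsmul', -⟩ := redFrac_facts he ha'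
  have hq : (redFrac e a).1 = (redFrac e a').1 := by rw [h]
  have hb : (redFrac e a).2 = (redFrac e a').2 := by rw [h]
  have hq0 : 0 < (redFrac e a).1 := by
    rcases Nat.eq_zero_or_pos (redFrac e a).1 with h0 | h0
    · rw [h0, zero_mul] at hqg; omega
    · exact h0
  have hgg : fracGcd e a = fracGcd e a' := by
    have : (redFrac e a).1 * fracGcd e a = (redFrac e a).1 * fracGcd e a' := by rw [hqg, hq, hqg']
    exact Nat.eq_of_mul_eq_mul_left hq0 this
  rw [← hsmul, ← hsmul', hgg, hb]

open scoped Classical in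
/-- **Reduction to lowest terms**: `∑_{a (mod e)} |S(a/e)|² ≤ ∑_{q ∣ e} ∑*_{b (mod q)} |S(b/q)|²`.
[cite: HeathBrownActa2001, §13 p. 78] -/
theorem Tsum_le_sum_divisors_Ustar {e : ℕ} (he : 0 < e) (w : ℤ × ℤ × ℤ → ℝ) (C : Finset (ℤ × ℤ × ℤ)) :
    Tsum w C e ≤ ∑ q ∈ e.divisors, Ustar w C q := by
  classical
  have hre : Tsum w C e = ∑ a ∈ resVecs e, ‖Sfrac w C (redFrac e a).1 (redFrac e a).2‖ ^ 2 := by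
    refine sum_congr rfl fun a ha => ?_
    rw [Sfrac_redFrac he w C ha]
  rw [hre, ← sum_image (f := fun x : (_ : ℕ) × (ℤ × ℤ × ℤ) => ‖Sfrac w C x.1 x.2‖ ^ 2) (redFrac_injOn he)]
  have hsub : (resVecs e).image (redFrac e) ⊆ e.divisors.sigma fun q => primRes q := by
    intro x hx
    obtain ⟨a, ha, rfl⟩ := mem_image.mp hx
    obtain ⟨-, -, -, hmem, hcop, hdvd, -⟩ := redFrac_facts he (mem_coe.mp ha)
    rw [mem_sigma, Nat.mem_divisors]
    exact ⟨⟨hdvd, he.ne'⟩, by rw [primRes, mem_filter]; exact ⟨hmem, hcop⟩⟩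
  calc ∑ x ∈ (resVecs e).image (redFrac e), ‖Sfrac w C x.1 x.2‖ ^ 2
      ≤ ∑ x ∈ e.divisors.sigma (fun q => primRes q), ‖Sfrac w C x.1 x.2‖ ^ 2 :=
        sum_le_sum_of_subset_of_nonneg hsub fun _ _ _ => by positivity
    _ = ∑ q ∈ e.divisors, Ustar w C q := by rw [sum_sigma]; rfl

/-! ### The weights -/

open scoped Classical in
/-- **The weight of `q`**: `w(q) = ∑_{Δ₀ < D ≤ Dmax} ∑_{1 ≤ d ≤ d₀/D, q ∣ dD} (dD)⁻²`.
[cite: HeathBrownActa2001, §13 p. 78] -/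
def wt (Δ₀ : ℝ) (Dmax : ℕ) (d₀ : ℝ) (q : ℕ) : ℝ :=
  ∑ D ∈ (Icc 1 Dmax).filter (fun D : ℕ => Δ₀ < (D : ℝ)),
    ∑ d ∈ (Icc 1 ⌊d₀ / D⌋₊).filter (fun d : ℕ => q ∣ d * D), (((d * D : ℕ) : ℝ) ^ 2)⁻¹

/-- `σ(q) ≤ q(1 + log q)` (`q ≥ 1`). [folklore] -/
theorem sigma_one_le (q : ℕ) (hq : 1 ≤ q) : ∑ g ∈ q.divisors, (g : ℝ) ≤ q * (1 + Real.log q) := by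
  have hswap : ∑ g ∈ q.divisors, (g : ℝ) = ∑ g ∈ q.divisors, (q : ℝ) / g := by
    rw [← Nat.sum_div_divisors q (fun g => (g : ℝ))]
    refine sum_congr rfl fun g hg => ?_
    rw [Nat.mem_divisors] at hg
    rw [Nat.cast_div hg.1 (by exact_mod_cast (Nat.pos_of_dvd_of_pos hg.1 hq).ne')]
  rw [hswap]
  have hharm := harmonic_le_one_add_log q
  rw [harmonic_eq_sum_Icc] at hharm
  push_cast at hharm
  calc ∑ g ∈ q.divisors, (q : ℝ) / g = q * ∑ g ∈ q.divisors, ((g : ℝ))⁻¹ := by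
        rw [mul_sum]; refine sum_congr rfl fun g _ => ?_; rw [div_eq_mul_inv]
    _ ≤ q * ∑ g ∈ Icc 1 q, ((g : ℝ))⁻¹ := by
        refine mul_le_mul_of_nonneg_left ?_ (by positivity)
        refine sum_le_sum_of_subset_of_nonneg (fun g hg => ?_) (fun _ _ _ => by positivity)
        rw [Nat.mem_divisors] at hg
        rw [mem_Icc]; exact ⟨Nat.pos_of_dvd_of_pos hg.1 hq, Nat.le_of_dvd hq hg.1⟩
    _ ≤ q * (1 + Real.log q) := by gcongr

/-- `∑_{Δ₀/g < k ≤ M} k⁻² ≤ 2g/Δ₀` (`g ≥ 1`, `Δ₀ > 0`). [folklore] -/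
theorem sum_inv_sq_gt_div_le {Δ₀ : ℝ} (hΔ : 0 < Δ₀) {g : ℕ} (hg : 1 ≤ g) (M : ℕ) :
    ∑ k ∈ (Icc 1 M).filter (fun k : ℕ => Δ₀ / g < (k : ℝ)), (((k : ℕ) : ℝ) ^ 2)⁻¹ ≤ 2 * g / Δ₀ := by
  have hgR : (0 : ℝ) < g := by exact_mod_cast hg
  set K : ℕ := ⌊Δ₀ / g⌋₊ with hK
  have hsub : (Icc 1 M).filter (fun k : ℕ => Δ₀ / g < (k : ℝ)) ⊆ Ioo K (M + 1) := by
    intro k hk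
    rw [mem_filter, mem_Icc] at hk
    rw [mem_Ioo]
    refine ⟨?_, by omega⟩
    rw [hK]; exact (Nat.floor_lt (by positivity)).mpr hk.2
  calc ∑ k ∈ (Icc 1 M).filter (fun k : ℕ => Δ₀ / g < (k : ℝ)), (((k : ℕ) : ℝ) ^ 2)⁻¹
      ≤ ∑ k ∈ Ioo K (M + 1), (((k : ℕ) : ℝ) ^ 2)⁻¹ :=
        sum_le_sum_of_subset_of_nonneg hsub fun _ _ _ => by positivity
    _ ≤ 2 / ((K : ℝ) + 1) := sum_Ioo_inv_sq_le K (M + 1)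
    _ ≤ 2 * g / Δ₀ := by
        have hK1 : Δ₀ / g < (K : ℝ) + 1 := by rw [hK]; exact Nat.lt_floor_add_one _
        rw [div_le_div_iff₀ (by positivity) hΔ]
        have : Δ₀ < ((K : ℝ) + 1) * g := by rwa [div_lt_iff₀ hgR] at hK1
        nlinarith

/-- **`∑_{Δ₀ < D ≤ Dmax} (q, D)² D⁻² ≤ 2σ(q)/Δ₀`**. [cite: HeathBrownActa2001, §13 p. 78] -/
theorem sum_gcd_sq_div_sq_le {Δ₀ : ℝ} (hΔ : 0 < Δ₀) (Dmax : ℕ) {q : ℕ} (hq : 1 ≤ q) :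
    ∑ D ∈ (Icc 1 Dmax).filter (fun D : ℕ => Δ₀ < (D : ℝ)), ((Nat.gcd q D : ℝ) ^ 2) / ((D : ℝ) ^ 2) ≤
      2 * (∑ g ∈ q.divisors, (g : ℝ)) / Δ₀ := by
  classical
  set S := (Icc 1 Dmax).filter (fun D : ℕ => Δ₀ < (D : ℝ)) with hS
  -- fibre over `g = (q, D)`
  have hmaps : ∀ D ∈ S, Nat.gcd q D ∈ q.divisors := fun D _ => by
    rw [Nat.mem_divisors]; exact ⟨Nat.gcd_dvd_left _ _, by omega⟩
  rw [← sum_fiberwise_of_maps_to hmaps, mul_sum, sum_div]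
  refine sum_le_sum fun g hg => ?_
  rw [Nat.mem_divisors] at hg
  have hg1 : 1 ≤ g := Nat.pos_of_dvd_of_pos hg.1 hq
  have hgR : (0 : ℝ) < g := by exact_mod_cast hg1
  -- `D = g k` with `k > Δ₀/g`
  calc ∑ D ∈ S.filter (fun D => Nat.gcd q D = g), ((Nat.gcd q D : ℝ) ^ 2) / ((D : ℝ) ^ 2)
      = ∑ D ∈ S.filter (fun D => Nat.gcd q D = g), ((g : ℝ) ^ 2) / ((D : ℝ) ^ 2) := by
        refine sum_congr rfl fun D hD => ?_
        rw [mem_filter] at hD; rw [hD.2]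
    _ = ∑ D ∈ S.filter (fun D => Nat.gcd q D = g), (g : ℝ) ^ 2 / (((g * (D / g) : ℕ) : ℝ) ^ 2) := by
        refine sum_congr rfl fun D hD => ?_
        rw [mem_filter] at hD
        have h1 : g ∣ D := hD.2 ▸ Nat.gcd_dvd_right q D
        rw [Nat.mul_div_cancel' h1]
    _ = ∑ k ∈ (S.filter (fun D => Nat.gcd q D = g)).image (fun D => D / g),
          (g : ℝ) ^ 2 / (((g * k : ℕ) : ℝ) ^ 2) := by
        have hinj : Set.InjOn (fun D => D / g) (S.filter (fun D => Nat.gcd q D = g) : Set ℕ) := by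
          intro D hD D' hD' h
          simp only [coe_filter, Set.mem_setOf_eq] at hD hD'
          have h1 : g ∣ D := hD.2 ▸ Nat.gcd_dvd_right q D
          have h2 : g ∣ D' := hD'.2 ▸ Nat.gcd_dvd_right q D'
          simp only at h
          rw [← Nat.div_mul_cancel h1, ← Nat.div_mul_cancel h2, h]
        rw [sum_image hinj]
    _ ≤ ∑ k ∈ (Icc 1 Dmax).filter (fun k : ℕ => Δ₀ / g < (k : ℝ)), (g : ℝ) ^ 2 / (((g * k : ℕ) : ℝ) ^ 2) := by
        refine sum_le_sum_of_subset_of_nonneg (fun k hk => ?_) (fun _ _ _ => by positivity)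
        obtain ⟨D, hD, rfl⟩ := mem_image.mp hk
        rw [mem_filter, hS, mem_filter, mem_Icc] at hD
        obtain ⟨⟨⟨hD1, hDmax⟩, hΔD⟩, hgD⟩ := hD
        have h1 : g ∣ D := hgD ▸ Nat.gcd_dvd_right q D
        rw [mem_filter, mem_Icc]
        refine ⟨⟨?_, (Nat.div_le_self _ _).trans hDmax⟩, ?_⟩
        · exact Nat.div_pos (Nat.le_of_dvd (by omega) h1) hg1
        · rw [div_lt_iff₀ hgR]
          have : ((D / g : ℕ) : ℝ) * g = D := by
            rw [Nat.cast_div h1 hgR.ne']; field_simp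
          rw [this]; exact hΔD
    _ = ∑ k ∈ (Icc 1 Dmax).filter (fun k : ℕ => Δ₀ / g < (k : ℝ)), (((k : ℕ) : ℝ) ^ 2)⁻¹ := by
        refine sum_congr rfl fun k hk => ?_
        rw [mem_filter, mem_Icc] at hk
        have hk0 : (0 : ℝ) < k := by exact_mod_cast hk.1.1
        push_cast
        field_simp
    _ ≤ 2 * g / Δ₀ := sum_inv_sq_gt_div_le hΔ hg1 Dmax

/-- `∑_{d ≤ M, q' ∣ d} d⁻² ≤ 2/q'²` (`q' ≥ 1`). [folklore] -/
theorem sum_inv_sq_multiples_le {q' : ℕ} (hq' : 1 ≤ q') (M : ℕ) :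
    ∑ d ∈ (Icc 1 M).filter (fun d : ℕ => q' ∣ d), (((d : ℕ) : ℝ) ^ 2)⁻¹ ≤ 2 / ((q' : ℝ) ^ 2) := by
  classical
  have hqR : (0 : ℝ) < q' := by exact_mod_cast hq'
  -- `d = q' k`, `k ≤ M`
  have hinj : Set.InjOn (fun d => d / q') ((Icc 1 M).filter (fun d : ℕ => q' ∣ d) : Set ℕ) := by
    intro d hd d' hd' h
    simp only [coe_filter, Set.mem_setOf_eq] at hd hd'
    simp only at h
    rw [← Nat.div_mul_cancel hd.2, ← Nat.div_mul_cancel hd'.2, h]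
  have step : ∑ d ∈ (Icc 1 M).filter (fun d : ℕ => q' ∣ d), (((d : ℕ) : ℝ) ^ 2)⁻¹ =
      ∑ k ∈ ((Icc 1 M).filter (fun d : ℕ => q' ∣ d)).image (fun d => d / q'), ((((q' * k : ℕ) : ℝ)) ^ 2)⁻¹ := by
    rw [sum_image hinj]
    refine sum_congr rfl fun d hd => ?_
    rw [mem_filter] at hd
    rw [Nat.mul_div_cancel' hd.2]
  rw [step]
  have hsub : ((Icc 1 M).filter (fun d : ℕ => q' ∣ d)).image (fun d => d / q') ⊆ Icc 1 M := by
    intro k hk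
    obtain ⟨d, hd, rfl⟩ := mem_image.mp hk
    rw [mem_filter, mem_Icc] at hd
    rw [mem_Icc]
    exact ⟨Nat.div_pos (Nat.le_of_dvd (by omega) hd.2) hq', (Nat.div_le_self _ _).trans hd.1.2⟩
  calc ∑ k ∈ ((Icc 1 M).filter (fun d : ℕ => q' ∣ d)).image (fun d => d / q'), ((((q' * k : ℕ) : ℝ)) ^ 2)⁻¹
      ≤ ∑ k ∈ Icc 1 M, ((((q' * k : ℕ) : ℝ)) ^ 2)⁻¹ :=
        sum_le_sum_of_subset_of_nonneg hsub fun _ _ _ => by positivity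
    _ = ((q' : ℝ) ^ 2)⁻¹ * ∑ k ∈ Icc 1 M, (((k : ℕ) : ℝ) ^ 2)⁻¹ := by
        rw [mul_sum]; refine sum_congr rfl fun k hk => ?_
        rw [mem_Icc] at hk
        have hk0 : (0 : ℝ) < k := by exact_mod_cast hk.1
        push_cast; field_simp
    _ ≤ ((q' : ℝ) ^ 2)⁻¹ * 2 := by
        gcongr
        -- `∑_{k ≤ M} k⁻² ≤ 1 + ∑_{2 ≤ k ≤ M} k⁻² ≤ 2`
        rcases Nat.eq_zero_or_pos M with hM | hM
        · rw [hM]; simp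
        · have hsplit : Icc 1 M = insert 1 (Icc 2 M) := by
            ext k; simp only [mem_Icc, mem_insert]; omega
          rw [hsplit, sum_insert (by simp)]
          have := Literature.NumberTheory.Sieve.sum_Icc_inv_sq_le_one M
          norm_num
          linarith
    _ = 2 / ((q' : ℝ) ^ 2) := by ring

/-- **The weight bound** `w(q) ≤ 4(1 + log q)/(qΔ₀)` (`q ≥ 1`, `Δ₀ > 0`): for fixed `D`, `q ∣ dD` iff
`q/(q,D) ∣ d`, so the `d`-sum is `≤ 2(q,D)²/q²`; then `∑_D (q,D)²/D² ≤ 2σ(q)/Δ₀ ≤ 2q(1 + log q)/Δ₀`.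
(Heath-Brown: "`≪ τ(q) XY log V/(qV)`"; this form avoids `τ(q)`.) [cite: HeathBrownActa2001, §13 p. 78] -/
theorem wt_le {Δ₀ : ℝ} (hΔ : 0 < Δ₀) (Dmax : ℕ) (d₀ : ℝ) {q : ℕ} (hq : 1 ≤ q) :
    wt Δ₀ Dmax d₀ q ≤ 4 * (1 + Real.log q) / (q * Δ₀) := by
  classical
  have hqR : (0 : ℝ) < q := by exact_mod_cast hq
  -- inner sum for fixed `D`
  have hinner : ∀ D : ℕ, 1 ≤ D →
      ∑ d ∈ (Icc 1 ⌊d₀ / D⌋₊).filter (fun d : ℕ => q ∣ d * D), (((d * D : ℕ) : ℝ) ^ 2)⁻¹ ≤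
        2 * ((Nat.gcd q D : ℝ) ^ 2) / ((D : ℝ) ^ 2) / (q : ℝ) ^ 2 := by
    intro D hD
    have hDR : (0 : ℝ) < D := by exact_mod_cast hD
    set g := Nat.gcd q D with hg
    have hg1 : 1 ≤ g := Nat.gcd_pos_of_pos_left _ hq
    set q' := q / g with hq'
    have hq'1 : 1 ≤ q' := Nat.div_pos (Nat.le_of_dvd hq (Nat.gcd_dvd_left _ _)) hg1
    have hqg : q' * g = q := Nat.div_mul_cancel (Nat.gcd_dvd_left _ _)
    -- `q ∣ d D → q' ∣ d`
    have hdiv : ∀ d : ℕ, q ∣ d * D → q' ∣ d := by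
      intro d hd
      have hcop : Nat.Coprime q' (D / g) := by
        rw [hq', hg]; exact Nat.coprime_div_gcd_div_gcd (by omega)
      have h1 : q' * g ∣ d * (D / g * g) := by
        rw [hqg, Nat.div_mul_cancel (Nat.gcd_dvd_right _ _)]; exact hd
      have h2 : q' ∣ d * (D / g) := by
        have : q' * g ∣ d * (D / g) * g := by rw [mul_assoc]; exact h1
        exact Nat.dvd_of_mul_dvd_mul_right (by omega) this
      exact hcop.dvd_of_dvd_mul_right h2
    calc ∑ d ∈ (Icc 1 ⌊d₀ / D⌋₊).filter (fun d : ℕ => q ∣ d * D), (((d * D : ℕ) : ℝ) ^ 2)⁻¹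
        ≤ ∑ d ∈ (Icc 1 ⌊d₀ / D⌋₊).filter (fun d : ℕ => q' ∣ d), (((d * D : ℕ) : ℝ) ^ 2)⁻¹ := by
          refine sum_le_sum_of_subset_of_nonneg (fun d hd => ?_) (fun _ _ _ => by positivity)
          rw [mem_filter] at hd ⊢; exact ⟨hd.1, hdiv d hd.2⟩
      _ = ((D : ℝ) ^ 2)⁻¹ * ∑ d ∈ (Icc 1 ⌊d₀ / D⌋₊).filter (fun d : ℕ => q' ∣ d), (((d : ℕ) : ℝ) ^ 2)⁻¹ := by
          rw [mul_sum]; refine sum_congr rfl fun d hd => ?_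
          rw [mem_filter, mem_Icc] at hd
          have hd0 : (0 : ℝ) < d := by exact_mod_cast hd.1.1
          push_cast; field_simp
      _ ≤ ((D : ℝ) ^ 2)⁻¹ * (2 / ((q' : ℝ) ^ 2)) := by
          gcongr; exact sum_inv_sq_multiples_le hq'1 _
      _ = 2 * ((g : ℝ) ^ 2) / ((D : ℝ) ^ 2) / (q : ℝ) ^ 2 := by
          have hqR' : (q : ℝ) = (q' : ℝ) * g := by exact_mod_cast hqg.symm
          have hq'R : (0 : ℝ) < q' := by exact_mod_cast hq'1
          have hgR : (0 : ℝ) < g := by exact_mod_cast hg1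
          rw [hqR']; field_simp
  -- sum over `D`
  calc wt Δ₀ Dmax d₀ q
      ≤ ∑ D ∈ (Icc 1 Dmax).filter (fun D : ℕ => Δ₀ < (D : ℝ)), 2 * ((Nat.gcd q D : ℝ) ^ 2) / ((D : ℝ) ^ 2) / (q : ℝ) ^ 2 := by
        refine sum_le_sum fun D hD => ?_
        rw [mem_filter, mem_Icc] at hD
        exact hinner D hD.1.1
    _ = (2 / (q : ℝ) ^ 2) * ∑ D ∈ (Icc 1 Dmax).filter (fun D : ℕ => Δ₀ < (D : ℝ)),
          ((Nat.gcd q D : ℝ) ^ 2) / ((D : ℝ) ^ 2) := by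
        rw [mul_sum]; refine sum_congr rfl fun D _ => ?_; ring
    _ ≤ (2 / (q : ℝ) ^ 2) * (2 * (∑ g ∈ q.divisors, (g : ℝ)) / Δ₀) := by
        gcongr; exact sum_gcd_sq_div_sq_le hΔ Dmax hq
    _ ≤ (2 / (q : ℝ) ^ 2) * (2 * (q * (1 + Real.log q)) / Δ₀) := by
        gcongr; exact sigma_one_le q hq
    _ = 4 * (1 + Real.log q) / (q * Δ₀) := by field_simp; ring

/-! ### Exchanging the sums -/

open scoped Classical in
/-- **`∑_{(D,d)} (dD)⁻² T(dD) ≤ ∑_{q ≤ d₀} w(q) U*(q)`** (reduction to lowest terms and exchange of the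
finite sums; `T(dD) ≤ ∑_{q ∣ dD} U*(q)`). [cite: HeathBrownActa2001, §13 (13.2)] -/
theorem sum_pairs_Tsum_le {Δ₀ d₀ : ℝ} (hd₀ : 0 ≤ d₀) (Dmax : ℕ) (w : ℤ × ℤ × ℤ → ℝ) (C : Finset (ℤ × ℤ × ℤ)) :
    ∑ D ∈ (Icc 1 Dmax).filter (fun D : ℕ => Δ₀ < (D : ℝ)),
        ∑ d ∈ Icc 1 ⌊d₀ / D⌋₊, (((d * D : ℕ) : ℝ) ^ 2)⁻¹ * Tsum w C (d * D) ≤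
      ∑ q ∈ Icc 1 ⌊d₀⌋₊, wt Δ₀ Dmax d₀ q * Ustar w C q := by
  classical
  set SD := (Icc 1 Dmax).filter (fun D : ℕ => Δ₀ < (D : ℝ)) with hSD
  -- Step 1: `T(dD) ≤ ∑_{q ∣ dD} U*(q) = ∑_{q ≤ d₀, q ∣ dD} U*(q)`
  have step1 : ∀ D ∈ SD, ∀ d ∈ Icc 1 ⌊d₀ / D⌋₊,
      (((d * D : ℕ) : ℝ) ^ 2)⁻¹ * Tsum w C (d * D) ≤
        ∑ q ∈ (Icc 1 ⌊d₀⌋₊).filter (fun q : ℕ => q ∣ d * D), (((d * D : ℕ) : ℝ) ^ 2)⁻¹ * Ustar w C q := by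
    intro D hD d hd
    rw [hSD, mem_filter, mem_Icc] at hD
    rw [mem_Icc] at hd
    have hdD : 0 < d * D := Nat.mul_pos (by omega) (by omega)
    have hDR : (0 : ℝ) < D := by exact_mod_cast hD.1.1
    -- `d D ≤ d₀`
    have hdD_le : ((d * D : ℕ) : ℝ) ≤ d₀ := by
      have h1 : (d : ℝ) ≤ d₀ / D := by
        have := Nat.floor_le (show 0 ≤ d₀ / D by positivity)
        exact le_trans (by exact_mod_cast hd.2) this
      push_cast
      rwa [le_div_iff₀ hDR] at h1
    rw [← mul_sum]
    refine mul_le_mul_of_nonneg_left ((Tsum_le_sum_divisors_Ustar hdD w C).trans ?_) (by positivity)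
    refine sum_le_sum_of_subset_of_nonneg (fun q hq => ?_) (fun _ _ _ => Ustar_nonneg _ _ _)
    rw [Nat.mem_divisors] at hq
    rw [mem_filter, mem_Icc]
    refine ⟨⟨Nat.pos_of_dvd_of_pos hq.1 hdD, Nat.le_floor ?_⟩, hq.1⟩
    exact le_trans (by exact_mod_cast Nat.le_of_dvd hdD hq.1) hdD_le
  refine (sum_le_sum fun D hD => sum_le_sum fun d hd => step1 D hD d hd).trans (le_of_eq ?_)
  -- Step 2: exchange
  calc ∑ D ∈ SD, ∑ d ∈ Icc 1 ⌊d₀ / D⌋₊, ∑ q ∈ (Icc 1 ⌊d₀⌋₊).filter (fun q : ℕ => q ∣ d * D),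
          (((d * D : ℕ) : ℝ) ^ 2)⁻¹ * Ustar w C q
      = ∑ D ∈ SD, ∑ d ∈ Icc 1 ⌊d₀ / D⌋₊, ∑ q ∈ Icc 1 ⌊d₀⌋₊,
          (if q ∣ d * D then (((d * D : ℕ) : ℝ) ^ 2)⁻¹ * Ustar w C q else 0) := by
        simp only [sum_filter]
    _ = ∑ D ∈ SD, ∑ q ∈ Icc 1 ⌊d₀⌋₊, ∑ d ∈ Icc 1 ⌊d₀ / D⌋₊,
          (if q ∣ d * D then (((d * D : ℕ) : ℝ) ^ 2)⁻¹ * Ustar w C q else 0) :=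
        sum_congr rfl fun D _ => Finset.sum_comm
    _ = ∑ q ∈ Icc 1 ⌊d₀⌋₊, ∑ D ∈ SD, ∑ d ∈ Icc 1 ⌊d₀ / D⌋₊,
          (if q ∣ d * D then (((d * D : ℕ) : ℝ) ^ 2)⁻¹ * Ustar w C q else 0) := Finset.sum_comm
    _ = ∑ q ∈ Icc 1 ⌊d₀⌋₊, wt Δ₀ Dmax d₀ q * Ustar w C q := by
        refine sum_congr rfl fun q _ => ?_
        rw [wt, sum_mul]
        refine sum_congr rfl fun D _ => ?_
        rw [sum_filter, sum_mul]
        refine sum_congr rfl fun d _ => ?_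
        split_ifs <;> simp

end Literature.NumberTheory.Sieve.CubicSieve

end
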